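import Summits.QuantumAdvantage.QuantumAdvantage.Theorems.AnchorDialFinal
import Summits.QuantumAdvantage.QuantumAdvantage.Theorems.HolonomyDialPlant
import Summits.QuantumAdvantage.QuantumAdvantage.Theorems.HolonomyDialAvoid

/-!
# AnchorDial — Fibre (cell decomp-qadv, seat lens-2, generation 14 rev 4; supports item 26531 `ExactnessDial.PolyLossOddU3`)

§12a of the node (rev 4, first half): gadgets (`HolonomyDial.oddZeros_iff_zpar`, `HolonomyDial.const_mem_lowDeg`, `indP`, `indP_mem`, `indP_apply`) and the
VENDORED g13 §H5 fibre machinery — fibres over a free block (`joinAt`, `blk`, `card_fibre`, `joinAt_comp_mem`), block / window / prefix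
signs (`bsgn`, `wsgn`, `psgn`, `psgn_add`, `oddZeros_iff_psgn`, `bsgn_joinAt`, `bsgn_joinAt_of_disjoint`, `wsgn_eq`, `half_le_card_wsgn`).
The vendored declarations are VERBATIM g13 `HolonomyDial.lean` v6 §H5 = part 9 `HolonomyDialFibre.lean` of the g13 tree package (not yet
landed when this was cut; two call sites adapted: `HolonomyDial.oddZeros_iff_zpar`, `HolonomyDial.card_odd_le (n := …)`).  If the g13 part lands first, the census
lane may replace this file's §12a declarations by `open …Theorems.HolonomyDial (…)` of the same names.

Split (≤ 400 lines, part 8/10) of the node file `HOME/decomp-qadv-lens-2/g14/AnchorDial.lean` (rev 4; sha256 in SHA256SUMS.txt, farm rc 0, no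
placeholders); declarations verbatim, namespace `Summit.QuantumAdvantage.QuantumAdvantage.Theorems.AnchorDial`.  Record: NODE-g14.md.
-/

set_option linter.dupNamespace false
set_option linter.unusedVariables false

noncomputable section

open scoped Classical

namespace Summit.QuantumAdvantage.QuantumAdvantage.Theorems.AnchorDial

open Finset
open Literature.Computability.QuantumComplexity Literature.Computability.QuantumComplexity.RingHLF
open Literature.Computability.MetaComplexity Literature.Computability.MetaComplexity.Smolensky
open Summit.QuantumAdvantage.AdviceFreeQNC0
open Summit.QuantumAdvantage.QuantumAdvantage.Theses (ExactnessDial.PolyLossOddU3 ExactnessDial.DPLift3)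
-- only the tree gadgets we use (the g13 package keeps landing under `Theorems.HolonomyDial`; no blanket `open`)
open Summit.QuantumAdvantage.QuantumAdvantage.Theorems.HolonomyDial (sq_sign_prod zpar_sign oddZeros_iff_prod mono_singleton_apply)

variable {N : ℕ}

/-! ## §12 (E2) Five-block Smolensky equidistribution — `Equi5Hyp` PROVED, hence the crux `MovingPointerLoss3`

§12a VENDORS g13 §H5 verbatim (fibres over a free block, block / window / prefix signs, the fibre-wise Smolensky
step `fibre_step`, the block step `step_le`, `step_two_sided`; tree parts `HolonomyDialFibre` / `HolonomyDialChain`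
of the g13 package, not yet landed at the time of writing — replace by `open … HolonomyDial (…)` once they are).
§12b is new: the five-step chain over five pairwise disjoint free blocks with a block-blind side condition
(`chain5`), the sign bookkeeping turning «odd ∧ the four site parities = z» inside a (prefix-sign, tail-sign) class
into five block-sign conditions (`odd_zvec_iff`), the class sums, and `equi5_of`:
`Equi5 N D' (m+t) (2m+t) (3m+t) (4m+t) 2^(N-45)` for `m` odd, `t < m`, `5m+t+1 ≤ N`, `2^47·2D'·C(m,m/2) ≤ 2^m`;
§12c the asymptotics (`equi5Hyp`), the crux `movingPointerLoss3 : MovingPointerLoss3` and the node collapse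
`T ⟺ PtrLocLift3`. -/

section Gadgets

/-- `[L = a]` as a polynomial: `1 - (L - a)²` (vendored, g13 §A). -/
def indP (L : CubeFn (ZMod 3) N) (a : ZMod 3) : CubeFn (ZMod 3) N :=
  1 - (L - fun _ => a) * (L - fun _ => a)

/-- AnchorDialFibre helper `indP_mem` (decomp-qadv land package; see the module docstring). -/
theorem indP_mem {D : ℕ} {L : CubeFn (ZMod 3) N} (hL : L ∈ lowDeg (ZMod 3) N D) (a : ZMod 3) :
    indP L a ∈ lowDeg (ZMod 3) N (D + D) := by
  have h1 : (L - fun _ => a) ∈ lowDeg (ZMod 3) N D := Submodule.sub_mem _ hL (HolonomyDial.const_mem_lowDeg a D)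
  exact Submodule.sub_mem _ (one_mem_lowDeg _) (mul_mem_lowDeg_add h1 h1)

/-- AnchorDialFibre helper `indP_apply` (decomp-qadv land package; see the module docstring). -/
theorem indP_apply (L : CubeFn (ZMod 3) N) (a : ZMod 3) (x : Fin N → Bool) :
    indP L a x = if L x = a then 1 else 0 := by
  simp only [indP, Pi.sub_apply, Pi.mul_apply, Pi.one_apply]
  generalize L x = v
  revert v; revert a; decide

end Gadgets

/-! ### §12a (vendored g13 §H5) -/

section FibreV

/-- overwrite the block `[s, s+m)` of `ρ` with `w`. -/
def joinAt (s m : ℕ) (ρ : Fin N → Bool) (w : Fin m → Bool) : Fin N → Bool :=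
  fun j => if h : s ≤ j.val ∧ j.val < s + m then w ⟨j.val - s, by omega⟩ else ρ j

/-- the block `[s, s+m)` of `ρ`. -/
def blk (s m : ℕ) (hsm : s + m ≤ N) (ρ : Fin N → Bool) : Fin m → Bool := fun i => ρ ⟨s + i.val, by omega⟩

/-- AnchorDialFibre helper `joinAt_of_mem` (decomp-qadv land package; see the module docstring). -/
theorem joinAt_of_mem {s m : ℕ} (ρ : Fin N → Bool) (w : Fin m → Bool) {j : Fin N}
    (h : s ≤ j.val ∧ j.val < s + m) : joinAt s m ρ w j = w ⟨j.val - s, by omega⟩ := by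
  unfold joinAt; rw [dif_pos h]

/-- AnchorDialFibre helper `joinAt_of_not` (decomp-qadv land package; see the module docstring). -/
theorem joinAt_of_not {s m : ℕ} (ρ : Fin N → Bool) (w : Fin m → Bool) {j : Fin N}
    (h : ¬ (s ≤ j.val ∧ j.val < s + m)) : joinAt s m ρ w j = ρ j := by
  unfold joinAt; rw [dif_neg h]

/-- AnchorDialFibre helper `joinAt_blk` (decomp-qadv land package; see the module docstring). -/
theorem joinAt_blk {s m : ℕ} (hsm : s + m ≤ N) (ρ : Fin N → Bool) (w : Fin m → Bool) :
    joinAt s m (joinAt s m ρ w) (blk s m hsm ρ) = ρ := by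
  funext j
  by_cases h : s ≤ j.val ∧ j.val < s + m
  · rw [joinAt_of_mem _ _ h]
    unfold blk
    congr 1
    ext
    simp only
    omega
  · rw [joinAt_of_not _ _ h, joinAt_of_not _ _ h]

/-- AnchorDialFibre helper `blk_joinAt` (decomp-qadv land package; see the module docstring). -/
theorem blk_joinAt {s m : ℕ} (hsm : s + m ≤ N) (ρ : Fin N → Bool) (w : Fin m → Bool) :
    blk s m hsm (joinAt s m ρ w) = w := by
  funext i
  unfold blk
  rw [joinAt_of_mem _ _ (show s ≤ (⟨s + i.val, by omega⟩ : Fin N).val ∧ (⟨s + i.val, by omega⟩ : Fin N).val < s + m by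
    simp only; omega)]
  congr 1
  ext
  simp only
  omega

/-- AnchorDialFibre helper `joinAt_joinAt` (decomp-qadv land package; see the module docstring). -/
theorem joinAt_joinAt {s m : ℕ} (ρ : Fin N → Bool) (w w' : Fin m → Bool) :
    joinAt s m (joinAt s m ρ w) w' = joinAt s m ρ w' := by
  funext j
  by_cases h : s ≤ j.val ∧ j.val < s + m
  · rw [joinAt_of_mem _ _ h, joinAt_of_mem _ _ h]
  · rw [joinAt_of_not _ _ h, joinAt_of_not _ _ h, joinAt_of_not _ _ h]

/-- **fibre identity**: counting over the cube = summing fibre counts over all `ρ` (each fibre met `2^m` times). -/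
theorem card_fibre {s m : ℕ} (hsm : s + m ≤ N) (Q : (Fin N → Bool) → Prop) [DecidablePred Q] :
    2 ^ m * (univ.filter Q).card =
      ∑ ρ : Fin N → Bool, (univ.filter fun w : Fin m → Bool => Q (joinAt s m ρ w)).card := by
  set Pi := (univ : Finset ((Fin N → Bool) × (Fin m → Bool))).filter fun p => Q (joinAt s m p.1 p.2) with hPi
  have hR : Pi.card = ∑ ρ : Fin N → Bool, (univ.filter fun w : Fin m → Bool => Q (joinAt s m ρ w)).card := by
    rw [hPi, Finset.card_filter, Fintype.sum_prod_type]
    refine Finset.sum_congr rfl fun ρ _ => ?_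
    rw [Finset.card_filter]
  have hT : ((univ.filter Q) ×ˢ (univ : Finset (Fin m → Bool))).card = 2 ^ m * (univ.filter Q).card := by
    rw [Finset.card_product, card_univ]
    simp only [Fintype.card_pi, Fintype.card_bool, prod_const, card_univ, Fintype.card_fin]
    ring
  have inj : ∀ p p' : (Fin N → Bool) × (Fin m → Bool),
      (joinAt s m p.1 p.2, blk s m hsm p.1) = (joinAt s m p'.1 p'.2, blk s m hsm p'.1) → p = p' := by
    intro p p' h
    simp only [Prod.mk.injEq] at h
    obtain ⟨hj, hb⟩ := h
    have e1 : p.1 = p'.1 := by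
      rw [← joinAt_blk hsm p.1 p.2, ← joinAt_blk hsm p'.1 p'.2, hj, hb]
    have e2 : p.2 = p'.2 := by
      rw [← blk_joinAt hsm p.1 p.2, ← blk_joinAt hsm p'.1 p'.2, hj]
    exact Prod.ext e1 e2
  have h1 : Pi.card ≤ ((univ.filter Q) ×ˢ (univ : Finset (Fin m → Bool))).card := by
    refine Finset.card_le_card_of_injOn (fun p => (joinAt s m p.1 p.2, blk s m hsm p.1)) ?_ ?_
    · intro p hp
      rw [Finset.mem_coe, hPi, mem_filter] at hp
      rw [Finset.mem_coe, Finset.mem_product, mem_filter]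
      exact ⟨⟨mem_univ _, hp.2⟩, mem_univ _⟩
    · intro p _ p' _ h
      exact inj p p' h
  have h2 : ((univ.filter Q) ×ˢ (univ : Finset (Fin m → Bool))).card ≤ Pi.card := by
    refine Finset.card_le_card_of_injOn (fun p => (joinAt s m p.1 p.2, blk s m hsm p.1)) ?_ ?_
    · intro p hp
      rw [Finset.mem_coe, Finset.mem_product, mem_filter] at hp
      rw [Finset.mem_coe, hPi, mem_filter]
      refine ⟨mem_univ _, ?_⟩
      show Q (joinAt s m (joinAt s m p.1 p.2) (blk s m hsm p.1))
      rw [joinAt_blk]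
      exact hp.1.2
    · intro p _ p' _ h
      exact inj p p' h
  rw [← hT, ← hR]
  omega

/-- composing with the fibre map keeps the degree (in the free block variables). -/
theorem joinAt_comp_mem {s m : ℕ} (ρ : Fin N → Bool) {D : ℕ} {P : CubeFn (ZMod 3) N}
    (hP : P ∈ lowDeg (ZMod 3) N D) : (fun w => P (joinAt s m ρ w)) ∈ lowDeg (ZMod 3) m D := by
  refine Smolensky.comp_mem_lowDeg_of_coord (F := ZMod 3) (joinAt s m ρ) (fun j => ?_) hP
  by_cases h : s ≤ j.val ∧ j.val < s + m
  · have e : (fun u : Fin m → Bool => if joinAt s m ρ u j = true then (1 : ZMod 3) else 0) =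
        mono (ZMod 3) {(⟨j.val - s, by omega⟩ : Fin m)} := by
      funext u; rw [joinAt_of_mem _ _ h, mono_singleton_apply]
    rw [e]; exact mono_mem_lowDeg (by simp)
  · have e : (fun u : Fin m → Bool => if joinAt s m ρ u j = true then (1 : ZMod 3) else 0) =
        fun _ => if ρ j = true then (1 : ZMod 3) else 0 := by
      funext u; rw [joinAt_of_not _ _ h]
    rw [e]; exact HolonomyDial.const_mem_lowDeg _ _

/-- block zero-sign `Π_{j ∈ [s, s+m)} (-1)^{[x_j = 0]}`. -/
def bsgn (s m : ℕ) (x : Fin N → Bool) : ZMod 3 :=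
  ∏ j : Fin N, (if s ≤ j.val ∧ j.val < s + m ∧ x j = false then (-1 : ZMod 3) else 1)

/-- zero-sign of a window. -/
def wsgn {m : ℕ} (w : Fin m → Bool) : ZMod 3 := ∏ i : Fin m, (if w i = false then (-1 : ZMod 3) else 1)

/-- prefix zero-sign `(-1)^{zpar x k}`. -/
def psgn (x : Fin N → Bool) (k : ℕ) : ZMod 3 := if zpar x k then -1 else 1

/-- AnchorDialFibre helper `psgn_sq` (decomp-qadv land package; see the module docstring). -/
theorem psgn_sq (x : Fin N → Bool) (k : ℕ) : psgn x k * psgn x k = 1 := by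
  unfold psgn; cases zpar x k <;> decide

/-- AnchorDialFibre helper `bsgn_sq` (decomp-qadv land package; see the module docstring). -/
theorem bsgn_sq (s m : ℕ) (x : Fin N → Bool) : bsgn s m x * bsgn s m x = 1 := by
  unfold bsgn; rw [← pow_two, sq_sign_prod]

/-- AnchorDialFibre helper `bsgn_cases` (decomp-qadv land package; see the module docstring). -/
theorem bsgn_cases (s m : ℕ) (x : Fin N → Bool) : bsgn s m x = 1 ∨ bsgn s m x = -1 := by
  have h := bsgn_sq s m x
  generalize bsgn s m x = v at h
  revert v; decide

/-- prefix signs multiply over blocks. -/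
theorem psgn_add (x : Fin N → Bool) (s m : ℕ) : psgn x (s + m) = psgn x s * bsgn s m x := by
  unfold psgn bsgn
  rw [zpar_sign x (s + m), zpar_sign x s, ← Finset.prod_mul_distrib]
  refine Finset.prod_congr rfl fun j _ => ?_
  by_cases hx : x j = false
  · by_cases h1 : j.val < s
    · rw [if_pos ⟨by omega, hx⟩, if_pos ⟨h1, hx⟩, if_neg (fun h => absurd h.1 (by omega))]; ring
    · by_cases h2 : j.val < s + m
      · rw [if_pos ⟨h2, hx⟩, if_neg (fun h => h1 h.1), if_pos ⟨by omega, h2, hx⟩]; ring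
      · rw [if_neg (fun h => h2 h.1), if_neg (fun h => h1 h.1), if_neg (fun h => h2 h.2.1)]; ring
  · rw [if_neg (fun h => hx h.2), if_neg (fun h => hx h.2), if_neg (fun h => hx h.2.2)]; ring

/-- AnchorDialFibre helper `psgn_zero` (decomp-qadv land package; see the module docstring). -/
theorem psgn_zero (x : Fin N → Bool) : psgn x 0 = 1 := by unfold psgn; rw [zpar_zero]; rfl

/-- AnchorDialFibre helper `oddZeros_iff_psgn` (decomp-qadv land package; see the module docstring). -/
theorem oddZeros_iff_psgn (x : Fin N → Bool) : OddZeros x ↔ psgn x N = -1 := by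
  rw [HolonomyDial.oddZeros_iff_zpar]; unfold psgn; cases zpar x N <;> decide

/-- the block embedding. -/
def embBlk (s m : ℕ) (hsm : s + m ≤ N) : Fin m ↪ Fin N :=
  ⟨fun i => ⟨s + i.val, by omega⟩, fun i i' h => by
    have := congrArg Fin.val h
    simp only at this
    exact Fin.ext (by omega)⟩

/-- AnchorDialFibre helper `filter_blk_eq_map` (decomp-qadv land package; see the module docstring). -/
theorem filter_blk_eq_map {s m : ℕ} (hsm : s + m ≤ N) :
    (univ : Finset (Fin N)).filter (fun j => s ≤ j.val ∧ j.val < s + m) = (univ : Finset (Fin m)).map (embBlk s m hsm) := by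
  ext j
  rw [mem_filter, Finset.mem_map]
  constructor
  · rintro ⟨_, h1, h2⟩
    exact ⟨⟨j.val - s, by omega⟩, mem_univ _, by unfold embBlk; ext; simp only [Function.Embedding.coeFn_mk]; omega⟩
  · rintro ⟨i, _, rfl⟩
    unfold embBlk
    simp only [Function.Embedding.coeFn_mk, mem_univ, true_and]
    omega

/-- the block sign of a fibre point is the window sign of the free block. -/
theorem bsgn_joinAt {s m : ℕ} (hsm : s + m ≤ N) (ρ : Fin N → Bool) (w : Fin m → Bool) :
    bsgn s m (joinAt s m ρ w) = wsgn w := by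
  unfold bsgn wsgn
  have e : ∀ j : Fin N, (if s ≤ j.val ∧ j.val < s + m ∧ joinAt s m ρ w j = false then (-1 : ZMod 3) else 1) =
      if s ≤ j.val ∧ j.val < s + m then (if joinAt s m ρ w j = false then (-1 : ZMod 3) else 1) else 1 := by
    intro j
    by_cases h : s ≤ j.val ∧ j.val < s + m
    · rw [if_pos h]
      by_cases hx : joinAt s m ρ w j = false
      · rw [if_pos ⟨h.1, h.2, hx⟩, if_pos hx]
      · rw [if_neg (fun h' => hx h'.2.2), if_neg hx]
    · rw [if_neg h, if_neg (fun h' => h ⟨h'.1, h'.2.1⟩)]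
  simp_rw [e]
  rw [← Finset.prod_filter, filter_blk_eq_map hsm, Finset.prod_map]
  refine Finset.prod_congr rfl fun i _ => ?_
  have hmem : s ≤ ((embBlk s m hsm) i).val ∧ ((embBlk s m hsm) i).val < s + m := by
    unfold embBlk; simp only [Function.Embedding.coeFn_mk]; omega
  rw [joinAt_of_mem _ _ hmem]
  have ei : (⟨((embBlk s m hsm) i).val - s, by have := hmem; omega⟩ : Fin m) = i := by
    unfold embBlk; ext; simp only [Function.Embedding.coeFn_mk]; omega
  rw [ei]

/-- a block sign is blind to the other blocks. -/
theorem bsgn_joinAt_of_disjoint {s m s' m' : ℕ} (hd : s' + m' ≤ s ∨ s + m ≤ s') (ρ : Fin N → Bool) (w : Fin m → Bool) :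
    bsgn s' m' (joinAt s m ρ w) = bsgn s' m' ρ := by
  unfold bsgn
  refine Finset.prod_congr rfl fun j _ => ?_
  by_cases h : s' ≤ j.val ∧ j.val < s' + m'
  · rw [joinAt_of_not _ _ (fun h' => by omega)]
  · rw [if_neg (fun h' => h ⟨h'.1, h'.2.1⟩), if_neg (fun h' => h ⟨h'.1, h'.2.1⟩)]

/-- the window sign is Smolensky's order-2 character up to `(-1)^m`. -/
theorem wsgn_eq {m : ℕ} (w : Fin m → Bool) : wsgn w = (-1) ^ m * omMono (2 : ZMod 3) univ w := by
  unfold wsgn omMono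
  rw [show ((-1 : ZMod 3)) ^ m = ∏ _i : Fin m, (-1 : ZMod 3) by rw [Finset.prod_const, card_univ, Fintype.card_fin],
    ← Finset.prod_mul_distrib]
  refine Finset.prod_congr rfl fun i _ => ?_
  cases w i <;> decide

/-- AnchorDialFibre helper `wsgn_cases` (decomp-qadv land package; see the module docstring). -/
theorem wsgn_cases {m : ℕ} (w : Fin m → Bool) : wsgn w = 1 ∨ wsgn w = -1 := by
  have h : wsgn w * wsgn w = 1 := by unfold wsgn; rw [← pow_two, sq_sign_prod]
  generalize wsgn w = v at h
  revert v; decide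

/-- both window-sign classes are at least half the cube (`m ≥ 3`). -/
theorem half_le_card_wsgn {m : ℕ} (hm3 : 3 ≤ m) (τ : ZMod 3) (hτ : τ = 1 ∨ τ = -1) :
    2 ^ (m - 1) ≤ (univ.filter fun w : Fin m → Bool => wsgn w = τ).card := by
  obtain ⟨k, rfl⟩ : ∃ k, m = k + 1 := ⟨m - 1, by omega⟩
  rw [Nat.add_sub_cancel]
  have eodd : (univ.filter fun w : Fin (k + 1) → Bool => wsgn w = -1) = univ.filter fun w => OddZeros w := by
    refine filter_congr fun w _ => ?_
    rw [oddZeros_iff_prod]; rfl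
  have hlo : 2 ^ k ≤ (univ.filter fun w : Fin (k + 1) → Bool => wsgn w = -1).card := by
    rw [eodd]; exact Theorems.ExactnessDialOddToAll.two_pow_le_card_odd
  have hhi : (univ.filter fun w : Fin (k + 1) → Bool => wsgn w = -1).card ≤ 2 ^ k := by
    rw [eodd]; have := HolonomyDial.card_odd_le (n := k + 1) (by omega); simpa using this
  rcases hτ with rfl | rfl
  · have htot := Finset.card_filter_add_card_filter_not (s := (univ : Finset (Fin (k + 1) → Bool))) (fun w => wsgn w = -1)
    have hc : (univ : Finset (Fin (k + 1) → Bool)).card = 2 ^ (k + 1) := by simp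
    rw [hc] at htot
    have e1 : (univ.filter fun w : Fin (k + 1) → Bool => ¬ wsgn w = -1) = univ.filter fun w => wsgn w = 1 := by
      refine filter_congr fun w _ => ?_
      rcases wsgn_cases w with h | h
      · rw [h]; decide
      · rw [h]; decide
    rw [e1, pow_succ] at htot
    omega
  · exact hlo


end FibreV

end Summit.QuantumAdvantage.QuantumAdvantage.Theorems.AnchorDial

end
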